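import Literature.AlgebraicGeometry.Frobenioids.Thm49SufficesRightEqLeftProofs
import Literature.AlgebraicGeometry.Frobenioids.DivisorMonoidRightEqLeftWeak
import Literature.AlgebraicGeometry.Frobenioids.Thm49RightTransportMultiplicativeWeak
import Literature.AlgebraicGeometry.Frobenioids.Thm49FunctorialBaseIsosWeak
import HarnessLib

/-!
# [FrdI] Theorem 4.9, row T49-L02 `SufficesRightEqLeft` PROVED in the WEAK setting (weakly perf-factorial
# divisor monoids)

Mochizuki, *The geometry of Frobenioids I: the general theory*, Kyushu J. Math. **62** (2008)
293–400, §4, proof of Theorem 4.9, p. 89 ll. 6–36: "it suffices to show that the right-hand and left-hand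
isomorphisms of Theorem 4.2, (iii), coincide for all universally Div-Frobenius-trivial objects"
[cite: MochizukiFrdI2008, Thm. 4.9 p.89].

PROOF-ONLY file (cell abc-iut, layer L1, seat abc-iut-L1-t14; row «C411iii/iv-WEAK» = the [FrdI] Thm. 4.9 /
Cor. 4.11 (iii)(iv) chain over `IsPerfFactorialWeak`, block (T2)). WEAK-HYPOTHESIS TWINS of
`Thm49SufficesRightEqLeftProofs.lean` (seat abc-iut-w4-d035) over `FrdI.T42.SettingWeak` (`Thm42SubWeak.lean`;
"`Φ_i` perf-factorial" weakened to "`Φ_i` weakly perf-factorial", Def. 2.4 (i) (a)(b)(c) + (d_ord) + (d_res);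
cell finding F-L2d2-1): `FrdI.T49.transport_mul_and_leftClause_at_weak`,
`transport_mul_of_forall_rightEqLeftAt_weak`, and **`sufficesRightEqLeft_holds_weak`** — the row T49-L02
statement `FrdI.T49.SufficesRightEqLeft` (a `Prop` quantifying over `T42.Setting`, `Thm49Sub.lean`) with its
binders written out over a `T42.SettingWeak` (the three binders of the typed row that its strong proof does not
use — "`Ψ^{±1}` preserve primary pre-steps", the carrier clause of `e` — are dropped), and
`subsetPhiPreserved_weak` (row T49-L03 objectwise). Inputs BY NAME: `exists_mulEquiv_of_rightEqLeftAt_family_weak`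
(`DivisorMonoidRightEqLeftWeak.lean`), `PreFrobenioid.transport_mul_of_preStep_to_weak`
(`Thm49RightTransportMultiplicativeWeak.lean`), `sufficesRightEqLeft_conclusion_of_forall_exists_weak`
(`Thm49FunctorialBaseIsosWeak.lean`), and the hypothesis-free `PreFrobenioid.exists_divTransport`,
`transport_mul_of_preStep_from`, `map_one_of_dvd_iff`. Proofs verbatim. No new definitions; nothing of the paper
restated or strengthened; nothing here is specific to the abc programme and no side is taken on [IUTchIII] Cor. 3.12.
-/

namespace Literature.AlgebraicGeometry.Frobenioids

open CategoryTheory Opposite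

universe w v v' u u'

namespace FrdI.T49


variable {D₁ : Type u} [Category.{v} D₁] {Φ₁ : D₁ᵒᵖ ⥤ CommMonCat.{w}} {C₁ : Type u'}
  [Category.{v'} C₁] {D₂ : Type u} [Category.{v} D₂] {Φ₂ : D₂ᵒᵖ ⥤ CommMonCat.{w}} {C₂ : Type u'}
  [Category.{v'} C₂] {F₁ : C₁ ⥤ ElemFrobenioid Φ₁} {F₂ : C₂ ⥤ ElemFrobenioid Φ₂} {Ψ : C₁ ≌ C₂}

/-- (WEAK setting; twin of `transport_mul_and_leftClause_at`.) **Right-hand = left-hand at `O` for the divisor transport.** In a `T42.SettingWeak`, at a universally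
Div-Frobenius-trivial `O` where `RightEqLeftAt` holds for every prime (with the primes `e O 𝔭` of the
`Ψ^Prime`-datum `e`), ANY family `T` with the pre-step clause `T_A(Div φ) = Div(Ψφ)` is multiplicative
at `O` and satisfies the left-hand clause at `O`: `(Ψψ)^* T_O(y) = Div(Ψψ)` whenever `ψ^* y = Div ψ` for
a pre-step `ψ` into `O` (the isomorphism of `exists_mulEquiv_of_rightEqLeftAt_family_weak` agrees with `T_O`
by Def. 1.3 (iii)(d)). [cite: MochizukiFrdI2008, Thm. 4.9 p.89] -/
theorem transport_mul_and_leftClause_at_weak (S : T42.SettingWeak F₁ F₂ Ψ)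
    (T : ∀ A : C₁, Φ₁.obj (op (PreFrobenioid.baseObj F₁ A)) →
      Φ₂.obj (op (PreFrobenioid.baseObj F₂ (Ψ.functor.obj A))))
    (hT : ∀ ⦃A B : C₁⦄ (φ : A ⟶ B), PreFrobenioid.IsPreStep F₁ φ →
      T A (PreFrobenioid.Div F₁ φ) = PreFrobenioid.Div F₂ (Ψ.functor.map φ))
    (e : ∀ A : C₁, Primes (Φ₁.obj (op (PreFrobenioid.baseObj F₁ A))) ≃
      Primes (Φ₂.obj (op (PreFrobenioid.baseObj F₂ (Ψ.functor.obj A)))))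
    (hRL : ∀ (A : C₁), PreFrobenioid.IsUniversallyDivFrobeniusTrivial F₁ A →
      ∀ 𝔭 : Primes (Φ₁.obj (op (PreFrobenioid.baseObj F₁ A))), RightEqLeftAt F₁ F₂ Ψ A 𝔭 (e A 𝔭))
    {O : C₁} (hO : PreFrobenioid.IsUniversallyDivFrobeniusTrivial F₁ O) :
    (∀ a b, T O (a * b) = T O a * T O b) ∧
      ∀ ⦃W : C₁⦄ (ψ : W ⟶ O), PreFrobenioid.IsPreStep F₁ ψ →
        ∀ y : Φ₁.obj (op (PreFrobenioid.baseObj F₁ O)),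
          pull Φ₁ (PreFrobenioid.Base F₁ ψ) y = PreFrobenioid.Div F₁ ψ →
            pull Φ₂ (PreFrobenioid.Base F₂ (Ψ.functor.map ψ)) (T O y) =
              PreFrobenioid.Div F₂ (Ψ.functor.map ψ) := by
  obtain ⟨M, hMR, hML⟩ := exists_mulEquiv_of_rightEqLeftAt_family_weak S e hRL hO
  -- `T_O = M` by "pre-steps with prescribed zero divisor" (Def. 1.3 (iii)(d))
  have hTM : ∀ x, T O x = M x := by
    intro x
    obtain ⟨B, φ, hφ, hφx⟩ := S.isFrobenioid₁.iii_d_under_surj O x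
    rw [← hφx, hT φ hφ.2, hMR φ hφ.2]
  refine ⟨fun a b => by rw [hTM, hTM, hTM, map_mul], fun W ψ hψ y hy => ?_⟩
  rw [hTM]
  exact hML ψ hψ y hy

/-- (WEAK setting; twin of `transport_mul_of_forall_rightEqLeftAt`.) **The divisor transport is multiplicative at EVERY object** (the extension step, p. 89 ll. 9–17),
given `RightEqLeftAt` for all primes at every universally Div-Frobenius-trivial object: Def. 1.3
(i)(a)(b) give, for any `X`, a Frobenius-trivial (hence universally Div-Frobenius-trivial, Rem. 1.11.1)
`O` and pre-steps `Y → X`, `Y → O`; then `PreFrobenioid.transport_mul_of_preStep_to_weak` at `Y` and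
`PreFrobenioid.transport_mul_of_preStep_from` along `Y → X`. [cite: MochizukiFrdI2008, Thm. 4.9 p.89] -/
theorem transport_mul_of_forall_rightEqLeftAt_weak (S : T42.SettingWeak F₁ F₂ Ψ)
    (T : ∀ A : C₁, Φ₁.obj (op (PreFrobenioid.baseObj F₁ A)) →
      Φ₂.obj (op (PreFrobenioid.baseObj F₂ (Ψ.functor.obj A))))
    (hTb : ∀ A, Function.Bijective (T A)) (hTd : ∀ A (x y), x ∣ y ↔ T A x ∣ T A y)
    (hT : ∀ ⦃A B : C₁⦄ (φ : A ⟶ B), PreFrobenioid.IsPreStep F₁ φ →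
      T A (PreFrobenioid.Div F₁ φ) = PreFrobenioid.Div F₂ (Ψ.functor.map φ))
    (e : ∀ A : C₁, Primes (Φ₁.obj (op (PreFrobenioid.baseObj F₁ A))) ≃
      Primes (Φ₂.obj (op (PreFrobenioid.baseObj F₂ (Ψ.functor.obj A)))))
    (hRL : ∀ (A : C₁), PreFrobenioid.IsUniversallyDivFrobeniusTrivial F₁ A →
      ∀ 𝔭 : Primes (Φ₁.obj (op (PreFrobenioid.baseObj F₁ A))), RightEqLeftAt F₁ F₂ Ψ A 𝔭 (e A 𝔭))
    (X : C₁) (a b : Φ₁.obj (op (PreFrobenioid.baseObj F₁ X))) : T X (a * b) = T X a * T X b := by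
  have hF₁ := S.isFrobenioid₁
  -- a Frobenius-trivial `O` over (an isomorph of) the base of `X`, and a span of pre-steps `X ← Y → O`
  obtain ⟨O, hOft, ⟨α⟩⟩ := hF₁.i_a (PreFrobenioid.baseObj F₁ X)
  obtain ⟨Y, φ, ψ, hφ, hψ, -⟩ := hF₁.i_b X O α.symm
  have hO : PreFrobenioid.IsUniversallyDivFrobeniusTrivial F₁ O :=
    PreFrobenioid.IsFrobeniusTrivial.isUniversallyDivFrobeniusTrivial hF₁ hOft
  obtain ⟨hmulO, hRLO⟩ := transport_mul_and_leftClause_at_weak S T hT e hRL hO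
  have hmulY : ∀ a b, T Y (a * b) = T Y a * T Y b :=
    PreFrobenioid.transport_mul_of_preStep_to_weak Ψ hF₁ S.isFrobenioid₂ S.perfect₁ S.isotropic₁
      S.perfFactorial₁ S.preStep_map T hTb hTd hT hmulO hRLO ψ hψ
  exact PreFrobenioid.transport_mul_of_preStep_from Ψ hF₁ S.isFrobenioid₂ S.preStep_map T hT φ hφ
    hmulY a b


/-- **[FrdI] Thm. 4.9, proof step T49-L02 (`SufficesRightEqLeft`), PROVED in the WEAK setting**: "it suffices
to show that the right-hand and left-hand isomorphisms of Theorem 4.2, (iii), coincide for all universally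
Div-Frobenius-trivial objects" (p. 89 ll. 6–36). In a `T42.SettingWeak`, given a family of bijections of primes
`e` (the `Ψ^Prime`-datum) and `RightEqLeftAt` at every universally Div-Frobenius-trivial object and every prime,
the divisor transports `T_A : Φ₁(A) → Φ₂(ΨA)` (Def. 1.3 (iii)(d), `exists_divTransport`) are isomorphisms of
monoids at EVERY `A` (`transport_mul_of_forall_rightEqLeftAt_weak`), computing `Div ∘ Ψ` on pre-steps; both
functoriality clauses follow (rows T49-L03/L04, `sufficesRightEqLeft_conclusion_of_forall_exists_weak`). This is
the body of the typed row `FrdI.T49.SufficesRightEqLeft` over the weak setting, with the binders its proof uses.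
[cite: MochizukiFrdI2008, Thm. 4.9 p.89] -/
theorem sufficesRightEqLeft_holds_weak (S : T42.SettingWeak F₁ F₂ Ψ)
    (e : ∀ A : C₁, Primes (Φ₁.obj (op (PreFrobenioid.baseObj F₁ A))) ≃
        Primes (Φ₂.obj (op (PreFrobenioid.baseObj F₂ (Ψ.functor.obj A)))))
    (hRL : ∀ (A : C₁), PreFrobenioid.IsUniversallyDivFrobeniusTrivial F₁ A →
        ∀ 𝔭 : Primes (Φ₁.obj (op (PreFrobenioid.baseObj F₁ A))), RightEqLeftAt F₁ F₂ Ψ A 𝔭 (e A 𝔭)) :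
    ∃ m : ∀ A : C₁, Φ₁.obj (op (PreFrobenioid.baseObj F₁ A)) ≃*
        Φ₂.obj (op (PreFrobenioid.baseObj F₂ (Ψ.functor.obj A))),
      (∀ ⦃A B : C₁⦄ (φ : A ⟶ B), PreFrobenioid.IsPreStep F₁ φ →
          m A (PreFrobenioid.Div F₁ φ) = PreFrobenioid.Div F₂ (Ψ.functor.map φ)) ∧
      ∀ ⦃A B : C₁⦄ (φ : A ⟶ B) (x : Φ₁.obj (op (PreFrobenioid.baseObj F₁ B))),
        m A (pull Φ₁ (PreFrobenioid.Base F₁ φ) x) = pull Φ₂ (PreFrobenioid.Base F₂ (Ψ.functor.map φ)) (m B x) := by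
  choose T hTb hTd hT using fun A : C₁ => PreFrobenioid.exists_divTransport Ψ S.isFrobenioid₁
    S.isFrobenioid₂ S.isotropic₁ S.isotropic₂ S.preStep_map S.preStep_inv A
  have hT' : ∀ ⦃A B : C₁⦄ (φ : A ⟶ B), PreFrobenioid.IsPreStep F₁ φ →
      T A (PreFrobenioid.Div F₁ φ) = PreFrobenioid.Div F₂ (Ψ.functor.map φ) :=
    fun A _ φ hφ => hT A φ hφ
  have hmul := transport_mul_of_forall_rightEqLeftAt_weak S T hTb hTd hT' e hRL
  refine sufficesRightEqLeft_conclusion_of_forall_exists_weak S fun A => ?_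
  have h1 : T A 1 = 1 := map_one_of_dvd_iff
    (S.isFrobenioid₂.isPreFrobenioid.isDivisorial _).isSharp (T A) (hTb A).2 (hTd A)
  let Tm : Φ₁.obj (op (PreFrobenioid.baseObj F₁ A)) →*
      Φ₂.obj (op (PreFrobenioid.baseObj F₂ (Ψ.functor.obj A))) :=
    { toFun := T A, map_one' := h1, map_mul' := hmul A }
  exact ⟨MulEquiv.ofBijective Tm (hTb A), fun B φ hφ => hT A φ hφ⟩

/-- **Row T49-L03 `SubsetPhiPreserved` in the WEAK setting, objectwise** ("maps the subset `Φ₁(A₁)` onto the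
subset `Φ₂(A₂)`", p. 89 ll. 25–33): in a `T42.SettingWeak` the transport "pre-steps with prescribed zero
divisor" `Div φ ↦ Div(Ψφ)` is a bijection `Φ₁(A) → Φ₂(ΨA)` compatible with `≤` (`PreFrobenioid.exists_divTransport`,
hypothesis-free in the monoids). [cite: MochizukiFrdI2008, Thm. 4.9 p.89] -/
theorem subsetPhiPreserved_weak (S : T42.SettingWeak F₁ F₂ Ψ) (A : C₁) :
    ∃ T : Φ₁.obj (op (PreFrobenioid.baseObj F₁ A)) → Φ₂.obj (op (PreFrobenioid.baseObj F₂ (Ψ.functor.obj A))),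
      Function.Bijective T ∧ (∀ x y, x ∣ y ↔ T x ∣ T y) ∧
        ∀ ⦃B : C₁⦄ (φ : A ⟶ B), PreFrobenioid.IsPreStep F₁ φ →
          T (PreFrobenioid.Div F₁ φ) = PreFrobenioid.Div F₂ (Ψ.functor.map φ) :=
  PreFrobenioid.exists_divTransport Ψ S.isFrobenioid₁ S.isFrobenioid₂ S.isotropic₁ S.isotropic₂ S.preStep_map
    S.preStep_inv A

end FrdI.T49

end Literature.AlgebraicGeometry.Frobenioids
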